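import Mathlib
import Summits.Ventures.HodgeRepro.Tier4.Line1.AdeleCocompact
import Summits.Ventures.HodgeRepro.Tier4.Line1.CocompactAssembly

/-!
# Tier4/Line1/AdelicBlichfeldtPi — adelic Blichfeldt for `kⁿ ⊆ 𝔸_kⁿ` (any finite index set), and compact sets of
large Haar measure

Blind re-derivation cell `pub-hodge-repro`, Tier 4 (README §9–§10), seat t4-L1-p5 (prover, LINE L1, gen 2).
`Tier4/Line1/AdeleCocompact.lean` has «`𝔸_k/k` is compact» (C3) and the adelic Blichfeldt lemma (C4) for `k⁴ ⊆ 𝔸_k⁴`;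
the torus case of the cocompactness wall (rung `hstab` (ii), the norm-one torus of `k(√−d)` inside `𝔸_k²`) needs the
same lemma for `k² ⊆ 𝔸_k²`.  This module re-proves C4 for an arbitrary finite index set `ι` (same proof: the principal
lattice is discrete and countable, C3 gives it a fundamental domain of finite measure, Mathlib's
`exists_pair_mem_lattice_not_disjoint_vadd` does the rest), and records the two bookkeeping facts the assembly uses:
`𝔸_kⁱ` is not compact, and a Haar measure on a σ-compact non-compact group has compact sets of arbitrarily large measure.

Nothing here says anything about the status of the Hodge conjecture for CM abelian varieties, which is NOT proved
(HC_CM is NOT proved by anyone in this repository).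
-/

set_option autoImplicit false

noncomputable section

namespace Summit.Ventures.HodgeRepro.Tier4.Line1

open NumberField MeasureTheory Topology Set Common
open scoped ENNReal Pointwise

section BlichfeldtPi

variable (k : Type) [Field k] [NumberField k] (ι : Type) [Fintype ι]

/-- the principal lattice `kⁱ ⊆ 𝔸_kⁱ` (coordinatewise principal adeles) is discrete -/
theorem principalLatticePi_discrete :
    DiscreteTopology (AddSubgroup.pi Set.univ
      (fun _ : ι => AdeleRing.principalSubgroup (𝓞 k) k)) := by
  haveI := principalSubgroup_discrete k
  refine DiscreteTopology.of_continuous_injective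
    (f := fun γ : AddSubgroup.pi Set.univ (fun _ : ι => AdeleRing.principalSubgroup (𝓞 k) k) =>
      fun i : ι => (⟨(γ : ι → AdeleRing (𝓞 k) k) i, γ.2 i (Set.mem_univ i)⟩ :
        AdeleRing.principalSubgroup (𝓞 k) k)) ?_ ?_
  · exact continuous_pi fun i =>
      Continuous.subtype_mk ((continuous_apply i).comp continuous_subtype_val) _
  · intro γ δ h
    apply Subtype.ext
    funext i
    have := congrArg (fun f => (f i : AdeleRing (𝓞 k) k)) h
    exact this

/-- the principal lattice `kⁱ ⊆ 𝔸_kⁱ` is countable (it injects into `kⁱ`) -/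
theorem principalLatticePi_countable :
    Countable (AddSubgroup.pi Set.univ
      (fun _ : ι => AdeleRing.principalSubgroup (𝓞 k) k)) := by
  haveI : Countable k := countable_numberField (k := k)
  classical
  let φ : AddSubgroup.pi Set.univ (fun _ : ι => AdeleRing.principalSubgroup (𝓞 k) k) → (ι → k) :=
    fun γ i => Classical.choose (γ.2 i (Set.mem_univ i))
  have hφ : Function.Injective φ := by
    intro γ δ h
    apply Subtype.ext
    funext i
    have hγ := Classical.choose_spec (γ.2 i (Set.mem_univ i))
    have hδ := Classical.choose_spec (δ.2 i (Set.mem_univ i))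
    have := congrArg (fun f => f i) h
    simp only [φ] at this
    rw [← hγ, ← hδ, this]
  exact hφ.countable

/-- (C4, any finite index set) **Adelic Blichfeldt**: for every Haar measure `μ` on `𝔸_kⁱ` there is a finite
constant `c` such that every measurable `S` with `μ S > c` contains two points differing by a non-zero rational
vector.  Unconditional: C3 is `exists_compact_add_principal` (`Tier4/Line1/AdeleCocompact.lean`). -/
theorem exists_ne_zero_rational_mem_sub_pi [MeasurableSpace (ι → AdeleRing (𝓞 k) k)]
    [BorelSpace (ι → AdeleRing (𝓞 k) k)] (μ : Measure (ι → AdeleRing (𝓞 k) k))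
    [μ.IsAddHaarMeasure] :
    ∃ c : ℝ≥0∞, c < ∞ ∧ ∀ S : Set (ι → AdeleRing (𝓞 k) k), MeasurableSet S → c < μ S →
      ∃ x : ι → k, x ≠ 0 ∧ ∃ s ∈ S, ∃ t ∈ S,
        s - t = fun i => algebraMap k (AdeleRing (𝓞 k) k) (x i) := by
  classical
  obtain ⟨C, hC, hcov⟩ := exists_compact_add_principal k
  haveI := t2Space_adeleRing k
  let L : AddSubgroup (ι → AdeleRing (𝓞 k) k) :=
    AddSubgroup.pi Set.univ (fun _ : ι => AdeleRing.principalSubgroup (𝓞 k) k)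
  haveI : DiscreteTopology L := principalLatticePi_discrete k ι
  haveI : Countable L := principalLatticePi_countable k ι
  have hCι : IsCompact (Set.pi Set.univ (fun _ : ι => C)) := isCompact_univ_pi fun _ => hC
  have hcovι : ∀ x : ι → AdeleRing (𝓞 k) k, ∃ γ : L, ∃ c ∈ Set.pi Set.univ (fun _ : ι => C),
      x = (γ : ι → AdeleRing (𝓞 k) k) + c := by
    intro x
    choose a ha using fun i => hcov (x i)
    refine ⟨⟨fun i => algebraMap k (AdeleRing (𝓞 k) k) (a i), fun i _ => ⟨a i, rfl⟩⟩,
      fun i => x i - algebraMap k (AdeleRing (𝓞 k) k) (a i), fun i _ => ha i, ?_⟩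
    funext i
    simp
  obtain ⟨F, hF, hFc⟩ :=
    exists_isAddFundamentalDomain_isCompact_closure_of_isCompact L μ hCι hcovι
  refine ⟨μ F, ?_, ?_⟩
  · exact lt_of_le_of_lt (measure_mono subset_closure) hFc.measure_lt_top
  · intro S hS hμ
    obtain ⟨γ₁, γ₂, hne, hdisj⟩ :=
      exists_pair_mem_lattice_not_disjoint_vadd hF hS.nullMeasurableSet hμ
    rw [Set.not_disjoint_iff] at hdisj
    obtain ⟨z, hz₁, hz₂⟩ := hdisj
    rw [Set.mem_vadd_set] at hz₁ hz₂
    obtain ⟨s, hs, hzs⟩ := hz₁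
    obtain ⟨t, ht, hzt⟩ := hz₂
    have hdiff : s - t = (γ₂ : ι → AdeleRing (𝓞 k) k) - γ₁ := by
      have h1 : (γ₁ : ι → AdeleRing (𝓞 k) k) + s = z := hzs
      have h2 : (γ₂ : ι → AdeleRing (𝓞 k) k) + t = z := hzt
      rw [← h2] at h1
      calc s - t = ((γ₁ : ι → AdeleRing (𝓞 k) k) + s) - ((γ₁ : ι → AdeleRing (𝓞 k) k) + t) := by
            abel
        _ = ((γ₂ : ι → AdeleRing (𝓞 k) k) + t) - ((γ₁ : ι → AdeleRing (𝓞 k) k) + t) := by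
            rw [h1]
        _ = (γ₂ : ι → AdeleRing (𝓞 k) k) - γ₁ := by abel
    have hmem : ∀ i, ((γ₂ : ι → AdeleRing (𝓞 k) k) - γ₁) i ∈
        AdeleRing.principalSubgroup (𝓞 k) k := fun i => (L.sub_mem γ₂.2 γ₁.2) i (Set.mem_univ i)
    choose x hx using fun i => hmem i
    refine ⟨x, ?_, s, hs, t, ht, ?_⟩
    · intro hx0
      apply hne
      apply Subtype.ext
      have : (γ₂ : ι → AdeleRing (𝓞 k) k) - γ₁ = 0 := by
        funext i
        rw [← hx i, congrFun hx0 i, Pi.zero_apply, map_zero, Pi.zero_apply]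
      exact (sub_eq_zero.1 this).symm
    · rw [hdiff]
      funext i
      exact (hx i).symm

omit [Fintype ι] in
/-- `𝔸_kⁱ` is not compact for a non-empty index set (an infinite place is a non-compact completion). -/
theorem noncompactSpace_adelePi [Nonempty ι] : NoncompactSpace (ι → Ad k) := by
  classical
  obtain ⟨i₀⟩ := (inferInstance : Nonempty ι)
  obtain ⟨w⟩ := (inferInstance : Nonempty (InfinitePlace k))
  haveI := noncompactSpace_infinitePlaceCompletion (k := k) w
  refine ⟨fun hc => ?_⟩
  have hf : Continuous fun x : ι → Ad k => (x i₀).1 w :=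
    ((continuous_apply w).comp (continuous_fst.comp (continuous_apply i₀)))
  have hsurj : Function.Surjective fun x : ι → Ad k => (x i₀).1 w := by
    intro y
    refine ⟨fun _ => ((Function.update (0 : (v : InfinitePlace k) → v.Completion) w y :
      InfiniteAdeleRing k), 0), ?_⟩
    show Function.update (0 : (v : InfinitePlace k) → v.Completion) w y w = y
    exact Function.update_self w y 0
  have h1 : IsCompact (Set.univ : Set w.Completion) := by
    rw [← Set.image_univ_of_surjective hsurj]
    exact hc.image hf
  exact noncompact_univ w.Completion h1

end BlichfeldtPi

section LargeCompact

variable {G : Type*} [TopologicalSpace G] [SigmaCompactSpace G] [MeasurableSpace G]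

/-- In a σ-compact space, a measure of infinite total mass has compact sets of arbitrarily large measure. -/
theorem exists_isCompact_lt_measure_of_measure_univ_eq_top (μ : Measure G) (huniv : μ Set.univ = ∞)
    {c : ℝ≥0∞} (hc : c < ∞) : ∃ S : Set G, IsCompact S ∧ c < μ S := by
  have hcov : (Set.univ : Set G) = ⋃ n, compactCovering G n := (iUnion_compactCovering _).symm
  have hsup : μ Set.univ = ⨆ n, μ (compactCovering G n) := by
    rw [hcov]
    exact Monotone.measure_iUnion (s := compactCovering G) (compactCovering_subset _)
  obtain ⟨n, hn⟩ : ∃ n, c < μ (compactCovering G n) := by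
    rw [← lt_iSup_iff, ← hsup, huniv]
    exact hc
  exact ⟨compactCovering G n, isCompact_compactCovering _ n, hn⟩

end LargeCompact

end Summit.Ventures.HodgeRepro.Tier4.Line1

end
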